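import Summits.Ventures.PercRepro.Night2SeriesClassesThreeOneCellsC

/-!
# PercRepro — the series-class dichotomies at `(3, 1)`: the six cocircuits (general coloop form), a triangle and a
member beyond it, four or more closures (night-2, gen 23)

With the explicit class cells of `(3, 1)` (`Night2SeriesClassesThreeOneCells{A,B,C}`, passed as closers) and the
three-disjoint cells (`Night2ThreeFatCells{A,C}`): a triangle of 2-cocircuits and a fat thin member whose missed pair
is none of its three pairs give a `K₄` (the pair meets the triangle in one point — `sixCocircuits_of_triangle_and_pair'`,
series transitivity twice with the shared point not a coloop) or a triangle plus a disjoint pair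
(`localShadowHall_three_one_of_triangle_pair`); four or more fat thin closures close every `|G| = 11 … 17`
(`localShadowHall_three_one_of_four_le`: no sharing pair → three pairwise disjoint; a sharing pair → the triangle and
a member beyond it); a sharing pair with a third member either forms a triangle or closes
(`localShadowHall_three_one_of_sharing_third`).  The clause dichotomy and the residues R are in
`Night2SeriesClassesThreeOneCells{E,F}`.
-/

namespace PercRepro.Shadow

open Finset PerFlat ThmH

variable {α : Type*} [DecidableEq α] {M : Matroid α} [M.Finite]

/-- A point of a fat missed set is not a coloop. -/
theorem notMem_coloops_of_mem_sdiff_clF {q : ℕ} {G B : Finset α} (hG : G ∈ flatsQ M (q + 1))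
    (hd' : (gr M \ G).card ≤ q) (hB : B ∈ thinMembers M q G) {a : α} (ha : a ∈ G \ clF M B) :
    a ∉ coloops M G :=
  fun h => (Finset.mem_sdiff.1 ha).2 (coloops_subset_clF_of_mem_thinMembers hG hd' hB h)

/-- **The six cocircuits of a `K₄` class** (general form): the points are not coloops. -/
theorem sixCocircuits_of_triangle_and_pair' {q : ℕ} {G : Finset α} (hG : G ∈ flatsQ M (q + 1))
    {p x y z a : α} (hpx : p ≠ x) (hpy : p ≠ y) (hxy : x ≠ y)
    (hpG : p ∈ G) (hxG : x ∈ G) (hyG : y ∈ G) (hzG : z ∈ G)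
    (hpK : p ∉ coloops M G) (hxK : x ∉ coloops M G) (hyK : y ∉ coloops M G)
    (hH₀ : M.eRk ((G \ {p, x} : Finset α) : Set α) ≤ (q : ℕ∞))
    (hH₁ : M.eRk ((G \ {p, y} : Finset α) : Set α) ≤ (q : ℕ∞))
    (ha : a = p ∨ a = x ∨ a = y) (hz : z ≠ p ∧ z ≠ x ∧ z ≠ y)
    (hHa : M.eRk ((G \ {a, z} : Finset α) : Set α) ≤ (q : ℕ∞)) :
    ∀ u ∈ ({p, x, y, z} : Finset α), ∀ v ∈ ({p, x, y, z} : Finset α), u ≠ v →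
      M.eRk ((G \ {u, v} : Finset α) : Set α) ≤ (q : ℕ∞) := by
  obtain ⟨hzp, hzx, hzy⟩ := hz
  have hsd : ∀ {u v : α}, u ∈ G → v ∈ G → G \ (G \ {u, v}) = {u, v} := fun hu hv =>
    Finset.sdiff_sdiff_eq_self (Finset.insert_subset hu (Finset.singleton_subset_iff.2 hv))
  have tr : ∀ {u v w : α}, u ∈ G → v ∈ G → w ∈ G → u ≠ v → u ≠ w → v ≠ w → u ∉ coloops M G →
      M.eRk ((G \ {u, v} : Finset α) : Set α) ≤ (q : ℕ∞) → M.eRk ((G \ {u, w} : Finset α) : Set α) ≤ (q : ℕ∞) →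
      M.eRk ((G \ {v, w} : Finset α) : Set α) ≤ (q : ℕ∞) := by
    intro u v w hu hv hw huv huw hvw huK h1 h2
    exact eRk_sdiff_pair_le_of_series' hG h1 h2 (hsd hu hv) (hsd hu hw) huv huw hvw huK
  have comm : ∀ {u v : α}, M.eRk ((G \ {u, v} : Finset α) : Set α) ≤ (q : ℕ∞) →
      M.eRk ((G \ {v, u} : Finset α) : Set α) ≤ (q : ℕ∞) := by
    intro u v h; rwa [Finset.pair_comm]
  have hH₂ : M.eRk ((G \ {x, y} : Finset α) : Set α) ≤ (q : ℕ∞) := tr hpG hxG hyG hpx hpy hxy hpK hH₀ hH₁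
  have hpz : M.eRk ((G \ {p, z} : Finset α) : Set α) ≤ (q : ℕ∞) ∧
      M.eRk ((G \ {x, z} : Finset α) : Set α) ≤ (q : ℕ∞) ∧ M.eRk ((G \ {y, z} : Finset α) : Set α) ≤ (q : ℕ∞) := by
    rcases ha with rfl | rfl | rfl
    · exact ⟨hHa, tr hpG hxG hzG hpx hzp.symm hzx.symm hpK hH₀ hHa, tr hpG hyG hzG hpy hzp.symm hzy.symm hpK hH₁ hHa⟩
    · exact ⟨tr hxG hpG hzG hpx.symm hzx.symm hzp.symm hxK (comm hH₀) hHa, hHa,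
        tr hxG hyG hzG hxy hzx.symm hzy.symm hxK hH₂ hHa⟩
    · exact ⟨tr hyG hpG hzG hpy.symm hzy.symm hzp.symm hyK (comm hH₁) hHa,
        tr hyG hxG hzG hxy.symm hzy.symm hzx.symm hyK (comm hH₂) hHa, hHa⟩
  obtain ⟨hpz', hxz', hyz'⟩ := hpz
  intro u hu v hv huv
  simp only [Finset.mem_insert, Finset.mem_singleton] at hu hv
  rcases hu with rfl | rfl | rfl | rfl <;> rcases hv with rfl | rfl | rfl | rfl <;>
    first
    | exact absurd rfl huv
    | exact hH₀ | exact hH₁ | exact hpz' | exact hH₂ | exact hxz' | exact hyz'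
    | exact comm hH₀ | exact comm hH₁ | exact comm hpz' | exact comm hH₂ | exact comm hxz' | exact comm hyz'

/-- **A triangle and a fat thin member beyond its three pairs close `(3, 1)`** — through the `K₄` closer when the pair
meets the triangle, the triangle-plus-pair closer when it is disjoint. -/
theorem localShadowHall_three_one_of_triangle_pair {G : Finset α} (hG : G ∈ flatsQ M (5 + 1))
    (hd : (gr M \ G).card = 3)
    (cK4 : ∀ {p x y z : α}, p ≠ x → p ≠ y → p ≠ z → x ≠ y → x ≠ z → y ≠ z →
      (∀ a ∈ ({p, x, y, z} : Finset α), a ∉ coloops M G) →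
      (∀ a ∈ ({p, x, y, z} : Finset α), ∀ b ∈ ({p, x, y, z} : Finset α), a ≠ b →
        M.eRk ((G \ {a, b} : Finset α) : Set α) ≤ ((5 : ℕ) : ℕ∞)) → LocalShadowHall M 5 G)
    (c32 : ∀ {p x y u v : α}, p ≠ x → p ≠ y → x ≠ y → u ≠ v → Disjoint ({p, x, y} : Finset α) {u, v} →
      (∀ a ∈ ({p, x, y, u, v} : Finset α), a ∉ coloops M G) →
      M.eRk ((G \ {p, x} : Finset α) : Set α) ≤ ((5 : ℕ) : ℕ∞) →
      M.eRk ((G \ {p, y} : Finset α) : Set α) ≤ ((5 : ℕ) : ℕ∞) →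
      M.eRk ((G \ {x, y} : Finset α) : Set α) ≤ ((5 : ℕ) : ℕ∞) →
      M.eRk ((G \ {u, v} : Finset α) : Set α) ≤ ((5 : ℕ) : ℕ∞) → LocalShadowHall M 5 G)
    {B₀ B₁ B₂ : Finset α} (hB₀ : B₀ ∈ thinMembers M 5 G) (hB₁ : B₁ ∈ thinMembers M 5 G)
    (hB₂ : B₂ ∈ thinMembers M 5 G) (hc₂ : (G \ clF M B₂).card = 2)
    {p x y : α} (hP₀ : G \ clF M B₀ = {p, x}) (hP₁ : G \ clF M B₁ = {p, y})
    (hpx : p ≠ x) (hpy : p ≠ y) (hxy : x ≠ y)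
    (hQ₀ : G \ clF M B₂ ≠ {p, x}) (hQ₁ : G \ clF M B₂ ≠ {p, y}) (hQ₂ : G \ clF M B₂ ≠ {x, y}) :
    LocalShadowHall M 5 G := by
  have hd' : (gr M \ G).card ≤ 5 := by omega
  have hpG : p ∈ G := by
    have : p ∈ G \ clF M B₀ := by rw [hP₀]; simp
    exact (Finset.mem_sdiff.1 this).1
  have hxG : x ∈ G := by
    have : x ∈ G \ clF M B₀ := by rw [hP₀]; simp
    exact (Finset.mem_sdiff.1 this).1
  have hyG : y ∈ G := by
    have : y ∈ G \ clF M B₁ := by rw [hP₁]; simp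
    exact (Finset.mem_sdiff.1 this).1
  have hpK : p ∉ coloops M G := notMem_coloops_of_mem_sdiff_clF hG hd' hB₀ (by rw [hP₀]; simp)
  have hxK : x ∉ coloops M G := notMem_coloops_of_mem_sdiff_clF hG hd' hB₀ (by rw [hP₀]; simp)
  have hyK : y ∉ coloops M G := notMem_coloops_of_mem_sdiff_clF hG hd' hB₁ (by rw [hP₁]; simp)
  have hH₀ : M.eRk ((G \ {p, x} : Finset α) : Set α) ≤ ((5 : ℕ) : ℕ∞) := by
    have := eRk_clF_le_of_mem_thinMembers hB₀
    rwa [clF_eq_sdiff_sdiff_of_thin hB₀, hP₀] at this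
  have hH₁ : M.eRk ((G \ {p, y} : Finset α) : Set α) ≤ ((5 : ℕ) : ℕ∞) := by
    have := eRk_clF_le_of_mem_thinMembers hB₁
    rwa [clF_eq_sdiff_sdiff_of_thin hB₁, hP₁] at this
  have hH₂ : M.eRk ((G \ {x, y} : Finset α) : Set α) ≤ ((5 : ℕ) : ℕ∞) :=
    eRk_sdiff_pair_le_of_series' hG hH₀ hH₁
      (Finset.sdiff_sdiff_eq_self (Finset.insert_subset hpG (Finset.singleton_subset_iff.2 hxG)))
      (Finset.sdiff_sdiff_eq_self (Finset.insert_subset hpG (Finset.singleton_subset_iff.2 hyG))) hpx hpy hxy hpK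
  have hQK : ∀ a ∈ G \ clF M B₂, a ∉ coloops M G := fun a ha => notMem_coloops_of_mem_sdiff_clF hG hd' hB₂ ha
  by_cases hdisj : (G \ clF M B₂) ∩ {p, x, y} = ∅
  · obtain ⟨u, v, huv, hQ⟩ := Finset.card_eq_two.1 hc₂
    have hH₃ : M.eRk ((G \ {u, v} : Finset α) : Set α) ≤ ((5 : ℕ) : ℕ∞) := by
      have := eRk_clF_le_of_mem_thinMembers hB₂
      rwa [clF_eq_sdiff_sdiff_of_thin hB₂, hQ] at this
    have hdj : Disjoint ({p, x, y} : Finset α) {u, v} := by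
      rw [Finset.disjoint_left]
      intro z hz hz'
      have : z ∈ (G \ clF M B₂) ∩ {p, x, y} := Finset.mem_inter.2 ⟨hQ ▸ hz', hz⟩
      rw [hdisj] at this
      exact Finset.notMem_empty z this
    refine c32 hpx hpy hxy huv hdj ?_ hH₀ hH₁ hH₂ hH₃
    intro a ha
    simp only [Finset.mem_insert, Finset.mem_singleton] at ha
    rcases ha with rfl | rfl | rfl | rfl | rfl
    · exact hpK
    · exact hxK
    · exact hyK
    · exact hQK _ (by rw [hQ]; simp)
    · exact hQK _ (by rw [hQ]; simp)
  · obtain ⟨a, ha⟩ := Finset.nonempty_iff_ne_empty.2 hdisj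
    rw [Finset.mem_inter] at ha
    obtain ⟨u, v, huv, hQ⟩ := Finset.card_eq_two.1 hc₂
    have hz : ∃ z, G \ clF M B₂ = {a, z} ∧ a ≠ z := by
      rw [hQ] at ha ⊢
      rcases Finset.mem_insert.1 ha.1 with rfl | h
      · exact ⟨v, rfl, huv⟩
      · rw [Finset.mem_singleton] at h
        subst h
        exact ⟨u, Finset.pair_comm u a, fun h => huv h.symm⟩
    obtain ⟨z, hQz, haz⟩ := hz
    have hzG : z ∈ G := by
      have : z ∈ G \ clF M B₂ := by rw [hQz]; simp
      exact (Finset.mem_sdiff.1 this).1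
    have hzK : z ∉ coloops M G := hQK z (by rw [hQz]; simp)
    have hztri : z ∉ ({p, x, y} : Finset α) := by
      intro hzt
      rcases pair_eq_of_subset_triangle hpx hpy hxy haz ha.2 hzt with h | h | h
      · exact hQ₀ (hQz.trans h)
      · exact hQ₁ (hQz.trans h)
      · exact hQ₂ (hQz.trans h)
    simp only [Finset.mem_insert, Finset.mem_singleton, not_or] at hztri
    have ha' : a = p ∨ a = x ∨ a = y := by
      have := ha.2
      simp only [Finset.mem_insert, Finset.mem_singleton] at this
      exact this
    have hHa : M.eRk ((G \ {a, z} : Finset α) : Set α) ≤ ((5 : ℕ) : ℕ∞) := by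
      have := eRk_clF_le_of_mem_thinMembers hB₂
      rwa [clF_eq_sdiff_sdiff_of_thin hB₂, hQz] at this
    have hsix := sixCocircuits_of_triangle_and_pair' hG hpx hpy hxy hpG hxG hyG hzG hpK hxK hyK hH₀ hH₁ ha'
      ⟨hztri.1, hztri.2.1, hztri.2.2⟩ hHa
    refine cK4 hpx hpy (Ne.symm hztri.1) hxy (Ne.symm hztri.2.1) (Ne.symm hztri.2.2) ?_ hsix
    intro b hb
    simp only [Finset.mem_insert, Finset.mem_singleton] at hb
    rcases hb with rfl | rfl | rfl | rfl
    · exact hpK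
    · exact hxK
    · exact hyK
    · exact hzK

open scoped Classical in
/-- **Four or more fat thin closures close `(3, 1)`** (given the `K₄`, triangle-plus-pair and three-disjoint closers):
no sharing pair gives three pairwise disjoint missed sets; a sharing pair gives the triangle and a member beyond it. -/
theorem localShadowHall_three_one_of_four_le {G : Finset α} (hG : G ∈ flatsQ M (5 + 1))
    (hd : (gr M \ G).card = 3)
    (cK4 : ∀ {p x y z : α}, p ≠ x → p ≠ y → p ≠ z → x ≠ y → x ≠ z → y ≠ z →
      (∀ a ∈ ({p, x, y, z} : Finset α), a ∉ coloops M G) →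
      (∀ a ∈ ({p, x, y, z} : Finset α), ∀ b ∈ ({p, x, y, z} : Finset α), a ≠ b →
        M.eRk ((G \ {a, b} : Finset α) : Set α) ≤ ((5 : ℕ) : ℕ∞)) → LocalShadowHall M 5 G)
    (c32 : ∀ {p x y u v : α}, p ≠ x → p ≠ y → x ≠ y → u ≠ v → Disjoint ({p, x, y} : Finset α) {u, v} →
      (∀ a ∈ ({p, x, y, u, v} : Finset α), a ∉ coloops M G) →
      M.eRk ((G \ {p, x} : Finset α) : Set α) ≤ ((5 : ℕ) : ℕ∞) →
      M.eRk ((G \ {p, y} : Finset α) : Set α) ≤ ((5 : ℕ) : ℕ∞) →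
      M.eRk ((G \ {x, y} : Finset α) : Set α) ≤ ((5 : ℕ) : ℕ∞) →
      M.eRk ((G \ {u, v} : Finset α) : Set α) ≤ ((5 : ℕ) : ℕ∞) → LocalShadowHall M 5 G)
    (c3d : ∀ {B₀ B₁ B₂ : Finset α}, B₀ ∈ thinMembers M 5 G → B₁ ∈ thinMembers M 5 G → B₂ ∈ thinMembers M 5 G →
      (G \ clF M B₀).card ≤ 2 → (G \ clF M B₁).card ≤ 2 → (G \ clF M B₂).card ≤ 2 →
      (G \ clF M B₀) ∩ (G \ clF M B₁) = ∅ → (G \ clF M B₀) ∩ (G \ clF M B₂) = ∅ →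
      (G \ clF M B₁) ∩ (G \ clF M B₂) = ∅ → LocalShadowHall M 5 G)
    (h4 : 4 ≤ (fatClosures M 5 G 2).card) :
    LocalShadowHall M 5 G := by
  have hd' : (gr M \ G).card ≤ 5 := by omega
  have hc : ∀ {B : Finset α}, B ∈ thinMembers M 5 G → (G \ clF M B).card ≤ 2 → (G \ clF M B).card = 2 :=
    fun hB hle => le_antisymm hle
      (two_le_card_sdiff_of_not_lay0 hG hd' (mem_thinMembers.1 hB).1 (mem_thinMembers.1 hB).2)
  by_cases hshare : ∃ B₀' ∈ thinMembers M 5 G, ∃ B₁ ∈ thinMembers M 5 G, (G \ clF M B₀').card ≤ 2 ∧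
      (G \ clF M B₁).card ≤ 2 ∧ G \ clF M B₀' ≠ G \ clF M B₁ ∧ ((G \ clF M B₀') ∩ (G \ clF M B₁)).Nonempty
  · obtain ⟨B₀', hB₀', B₁, hB₁, hf₀, hf₁, hne, ⟨p, hp⟩⟩ := hshare
    obtain ⟨x, y, hP₀, hP₁, hpx, hpy, hxy⟩ := pair_shape_of_mem_inter (hc hB₀' hf₀) (hc hB₁ hf₁) hne hp
    obtain ⟨B₂, hB₂, hf₂, hQ₀, hQ₁, hQ₂⟩ := exists_fat_beyond_triangle h4 hB₀' hB₁ hP₀ hP₁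
    exact localShadowHall_three_one_of_triangle_pair hG hd cK4 c32 hB₀' hB₁ hB₂ (hc hB₂ hf₂) hP₀ hP₁ hpx hpy hxy
      hQ₀ hQ₁ hQ₂
  · push Not at hshare
    obtain ⟨B₀', hB₀', B₁, hB₁, B₂, hB₂, hf₀, hf₁, hf₂, h01, h02, h12⟩ :=
      exists_threeFat_of_two_lt_card_fatClosures (M := M) (q := 5) (G := G) (by omega)
    exact c3d hB₀' hB₁ hB₂ hf₀ hf₁ hf₂ (hshare B₀' hB₀' B₁ hB₁ hf₀ hf₁ h01) (hshare B₀' hB₀' B₂ hB₂ hf₀ hf₂ h02)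
      (hshare B₁ hB₁ B₂ hB₂ hf₁ hf₂ h12)

open scoped Classical in
/-- A sharing pair and a third member: either the three missed pairs form a triangle (union of `≤ 3` points) or the
cell closes. -/
theorem localShadowHall_three_one_of_sharing_third {G : Finset α} (hG : G ∈ flatsQ M (5 + 1))
    (hd : (gr M \ G).card = 3)
    (cK4 : ∀ {p x y z : α}, p ≠ x → p ≠ y → p ≠ z → x ≠ y → x ≠ z → y ≠ z →
      (∀ a ∈ ({p, x, y, z} : Finset α), a ∉ coloops M G) →
      (∀ a ∈ ({p, x, y, z} : Finset α), ∀ b ∈ ({p, x, y, z} : Finset α), a ≠ b →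
        M.eRk ((G \ {a, b} : Finset α) : Set α) ≤ ((5 : ℕ) : ℕ∞)) → LocalShadowHall M 5 G)
    (c32 : ∀ {p x y u v : α}, p ≠ x → p ≠ y → x ≠ y → u ≠ v → Disjoint ({p, x, y} : Finset α) {u, v} →
      (∀ a ∈ ({p, x, y, u, v} : Finset α), a ∉ coloops M G) →
      M.eRk ((G \ {p, x} : Finset α) : Set α) ≤ ((5 : ℕ) : ℕ∞) →
      M.eRk ((G \ {p, y} : Finset α) : Set α) ≤ ((5 : ℕ) : ℕ∞) →
      M.eRk ((G \ {x, y} : Finset α) : Set α) ≤ ((5 : ℕ) : ℕ∞) →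
      M.eRk ((G \ {u, v} : Finset α) : Set α) ≤ ((5 : ℕ) : ℕ∞) → LocalShadowHall M 5 G)
    {B₀ B₁ B₂ : Finset α} (hB₀ : B₀ ∈ thinMembers M 5 G) (hB₁ : B₁ ∈ thinMembers M 5 G)
    (hB₂ : B₂ ∈ thinMembers M 5 G) (hf₀ : (G \ clF M B₀).card ≤ 2) (hf₁ : (G \ clF M B₁).card ≤ 2)
    (hf₂ : (G \ clF M B₂).card ≤ 2) (h01 : G \ clF M B₀ ≠ G \ clF M B₁) (h02 : G \ clF M B₀ ≠ G \ clF M B₂)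
    (h12 : G \ clF M B₁ ≠ G \ clF M B₂) {p : α} (hp : p ∈ (G \ clF M B₀) ∩ (G \ clF M B₁))
    (hU : 3 < ((G \ clF M B₀) ∪ (G \ clF M B₁) ∪ (G \ clF M B₂)).card) :
    LocalShadowHall M 5 G := by
  have hd' : (gr M \ G).card ≤ 5 := by omega
  have hc : ∀ {B : Finset α}, B ∈ thinMembers M 5 G → (G \ clF M B).card ≤ 2 → (G \ clF M B).card = 2 :=
    fun hB hle => le_antisymm hle
      (two_le_card_sdiff_of_not_lay0 hG hd' (mem_thinMembers.1 hB).1 (mem_thinMembers.1 hB).2)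
  obtain ⟨x, y, hP₀, hP₁, hpx, hpy, hxy⟩ := pair_shape_of_mem_inter (hc hB₀ hf₀) (hc hB₁ hf₁) h01 hp
  by_cases hQ₂ : G \ clF M B₂ = {x, y}
  · exfalso
    have : (G \ clF M B₀) ∪ (G \ clF M B₁) ∪ (G \ clF M B₂) ⊆ {p, x, y} := by
      rw [hP₀, hP₁, hQ₂]
      intro z hz
      simp only [Finset.mem_union, Finset.mem_insert, Finset.mem_singleton] at hz ⊢
      tauto
    have := (Finset.card_le_card this).trans Finset.card_le_three
    omega
  · exact localShadowHall_three_one_of_triangle_pair hG hd cK4 c32 hB₀ hB₁ hB₂ (hc hB₂ hf₂) hP₀ hP₁ hpx hpy hxy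
      (hP₀ ▸ h02.symm) (hP₁ ▸ h12.symm) hQ₂

end PercRepro.Shadow
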